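import Mathlib
import Summits.Ventures.PercRepro2.TypedMaskPieces

/-!
# Graph lemmas for the virtual edges (blind cell PercRepro2, p2 g3, 2026-08-25)

Opening an edge adds its pair to the open graph (`openGraph_update_true`); the open graph does
not see the ends of a closed edge (`openGraph_update_ends_closed`); the graph of a pair mask is
the graph of the pair (`fromRel_relOf_cliq_pair`); the path `v₁ – v₃ – v₂` and the triangle have
the same reachability over any graph (`reachable_path_iff_tri`), and equally reachable graphs
have the same masked state (`stG_congr_reachable`). Tools for `TypedMaskInst.lean`.
-/

namespace Summit.Ventures.PercRepro2

namespace CovForm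

namespace TypedRed

namespace Mask

open TwoTerm OneTyped

section Graphs

variable {V : Type*} {E : Type*} [DecidableEq E]

/-- The open graph does not see the ends of a closed edge. -/
lemma openGraph_update_ends_closed (ends : E → Sym2 V) {x : Config E} {e : E} (hx : x e = false)
    (s : Sym2 V) : openGraph (Function.update ends e s) x = openGraph ends x := by
  ext u v
  rw [openGraph_adj, openGraph_adj]
  constructor
  · rintro ⟨huv, e', he', hends⟩
    have hne : e' ≠ e := fun h => by rw [h, hx] at he'; exact Bool.noConfusion he'
    rw [Function.update_of_ne hne] at hends
    exact ⟨huv, e', he', hends⟩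
  · rintro ⟨huv, e', he', hends⟩
    have hne : e' ≠ e := fun h => by rw [h, hx] at he'; exact Bool.noConfusion he'
    exact ⟨huv, e', he', by rw [Function.update_of_ne hne]; exact hends⟩

/-- Opening an edge adds its pair to the open graph. -/
lemma openGraph_update_true (ends : E → Sym2 V) (x : Config E) {e : E} {v w : V}
    (hends : ends e = s(v, w)) :
    openGraph ends (Function.update x e true) =
      openGraph ends x ⊔ SimpleGraph.fromRel (fun a b => a = v ∧ b = w) := by
  ext a b
  rw [SimpleGraph.sup_adj, openGraph_adj, openGraph_adj, SimpleGraph.fromRel_adj]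
  constructor
  · rintro ⟨hab, e', he', hends'⟩
    by_cases h : e' = e
    · subst h
      rw [hends] at hends'
      rcases Sym2.eq_iff.1 hends' with ⟨rfl, rfl⟩ | ⟨rfl, rfl⟩
      · exact Or.inr ⟨hab, Or.inl ⟨rfl, rfl⟩⟩
      · exact Or.inr ⟨hab, Or.inr ⟨rfl, rfl⟩⟩
    · rw [Function.update_of_ne h] at he'
      exact Or.inl ⟨hab, e', he', hends'⟩
  · rintro (⟨hab, e', he', hends'⟩ | ⟨hab, ⟨rfl, rfl⟩ | ⟨rfl, rfl⟩⟩)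
    · by_cases h : e' = e
      · subst h
        exact ⟨hab, e', by rw [Function.update_self], hends'⟩
      · exact ⟨hab, e', by rw [Function.update_of_ne h]; exact he', hends'⟩
    · exact ⟨hab, e, by rw [Function.update_self], hends⟩
    · exact ⟨hab, e, by rw [Function.update_self], by rw [hends, Sym2.eq_swap]⟩

/-- Closing an edge that is closed changes nothing. -/
lemma update_false_eq {x : Config E} {e : E} (hx : x e = false) :
    Function.update x e false = x := by
  conv_lhs => rw [← hx]
  exact Function.update_eq_self e x

end Graphs

section Masks

variable {V : Type*} [DecidableEq V]

omit [DecidableEq V] in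
/-- The graph of the empty mask is trivial. -/
lemma fromRel_relOf_empty : SimpleGraph.fromRel (relOf (∅ : Finset (V × V))) = ⊥ := by
  ext a b
  simp [SimpleGraph.fromRel_adj, relOf]

/-- The graph of a pair mask is the graph of the pair. -/
lemma fromRel_relOf_cliq_pair (v w : V) :
    SimpleGraph.fromRel (relOf (cliq {v, w})) = SimpleGraph.fromRel (fun a b => a = v ∧ b = w) := by
  ext a b
  simp only [SimpleGraph.fromRel_adj, relOf, mem_cliq, Finset.mem_insert, Finset.mem_singleton]
  constructor
  · rintro ⟨hab, ⟨ha, hb, hne⟩ | ⟨hb, ha, hne⟩⟩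
    · rcases ha with rfl | rfl <;> rcases hb with rfl | rfl
      · exact absurd rfl hne
      · exact ⟨hab, Or.inl ⟨rfl, rfl⟩⟩
      · exact ⟨hab, Or.inr ⟨rfl, rfl⟩⟩
      · exact absurd rfl hne
    · rcases ha with rfl | rfl <;> rcases hb with rfl | rfl
      · exact absurd rfl hne
      · exact ⟨hab, Or.inl ⟨rfl, rfl⟩⟩
      · exact ⟨hab, Or.inr ⟨rfl, rfl⟩⟩
      · exact absurd rfl hne
  · rintro ⟨hab, ⟨rfl, rfl⟩ | ⟨rfl, rfl⟩⟩
    · exact ⟨hab, Or.inl ⟨Or.inl rfl, Or.inr rfl, hab⟩⟩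
    · exact ⟨hab, Or.inr ⟨Or.inl rfl, Or.inr rfl, Ne.symm hab⟩⟩

omit [DecidableEq V] in
/-- Two graphs with the same reachability have the same masked state. -/
lemma stG_congr_reachable (o a₁ a₂ a₃ b : V) {G G' : SimpleGraph V}
    (h : ∀ p q, G.Reachable p q ↔ G'.Reachable p q) :
    stG o a₁ a₂ a₃ b G = stG o a₁ a₂ a₃ b G' := by
  unfold stG
  simp only [Prod.mk.injEq]
  exact ⟨decide_eq_decide.mpr (h _ _), decide_eq_decide.mpr (h _ _), decide_eq_decide.mpr (h _ _),
    decide_eq_decide.mpr (h _ _), decide_eq_decide.mpr (h _ _), decide_eq_decide.mpr (h _ _),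
    decide_eq_decide.mpr (h _ _)⟩

/-- The path `v₁ – v₃ – v₂` and the triangle on `{v₁, v₂, v₃}` have the same reachability over any
graph. -/
lemma reachable_path_iff_tri (G : SimpleGraph V) (v₁ v₂ v₃ : V) (p q : V) :
    (G ⊔ SimpleGraph.fromRel (fun a b => a = v₁ ∧ b = v₃) ⊔
      SimpleGraph.fromRel (fun a b => a = v₂ ∧ b = v₃)).Reachable p q ↔
    (G ⊔ SimpleGraph.fromRel (relOf (cliq {v₁, v₂, v₃}))).Reachable p q := by
  -- both are `G` with the three vertices identified
  set P := G ⊔ SimpleGraph.fromRel (fun a b => a = v₁ ∧ b = v₃) ⊔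
    SimpleGraph.fromRel (fun a b => a = v₂ ∧ b = v₃) with hP
  set T := G ⊔ SimpleGraph.fromRel (relOf (cliq {v₁, v₂, v₃})) with hT
  have hGP : G ≤ P := le_trans le_sup_left le_sup_left
  have hGT : G ≤ T := le_sup_left
  -- the path edges are reachable in `T`, the triangle edges in `P`
  have hT13 : T.Reachable v₁ v₃ := by
    by_cases h : v₁ = v₃
    · rw [h]
    · exact SimpleGraph.Adj.reachable (by
        rw [hT, SimpleGraph.sup_adj, SimpleGraph.fromRel_adj]
        exact Or.inr ⟨h, Or.inl (mem_cliq.2 ⟨by simp, by simp, h⟩)⟩)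
  have hT23 : T.Reachable v₂ v₃ := by
    by_cases h : v₂ = v₃
    · rw [h]
    · exact SimpleGraph.Adj.reachable (by
        rw [hT, SimpleGraph.sup_adj, SimpleGraph.fromRel_adj]
        exact Or.inr ⟨h, Or.inl (mem_cliq.2 ⟨by simp, by simp, h⟩)⟩)
  have hP13 : P.Reachable v₁ v₃ := by
    by_cases h : v₁ = v₃
    · rw [h]
    · exact SimpleGraph.Adj.reachable (by
        rw [hP, SimpleGraph.sup_adj, SimpleGraph.sup_adj, SimpleGraph.fromRel_adj]
        exact Or.inl (Or.inr ⟨h, Or.inl ⟨rfl, rfl⟩⟩))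
  have hP23 : P.Reachable v₂ v₃ := by
    by_cases h : v₂ = v₃
    · rw [h]
    · exact SimpleGraph.Adj.reachable (by
        rw [hP, SimpleGraph.sup_adj, SimpleGraph.fromRel_adj]
        exact Or.inr ⟨h, Or.inl ⟨rfl, rfl⟩⟩)
  -- every edge of either graph is reachable in the other
  have hPT : ∀ a b, P.Adj a b → T.Reachable a b := by
    intro a b hab
    rw [hP, SimpleGraph.sup_adj, SimpleGraph.sup_adj, SimpleGraph.fromRel_adj,
      SimpleGraph.fromRel_adj] at hab
    rcases hab with (hab | ⟨_, ⟨rfl, rfl⟩ | ⟨rfl, rfl⟩⟩) | ⟨_, ⟨rfl, rfl⟩ | ⟨rfl, rfl⟩⟩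
    · exact (hab.reachable).mono hGT
    · exact hT13
    · exact hT13.symm
    · exact hT23
    · exact hT23.symm
  have hTP : ∀ a b, T.Adj a b → P.Reachable a b := by
    intro a b hab
    rw [hT, SimpleGraph.sup_adj, SimpleGraph.fromRel_adj] at hab
    rcases hab with hab | ⟨_, h | h⟩
    · exact (hab.reachable).mono hGP
    · -- `(a, b)` a pair of distinct vertices of the triangle
      simp only [relOf, mem_cliq, Finset.mem_insert, Finset.mem_singleton] at h
      obtain ⟨ha, hb, _⟩ := h
      rcases ha with rfl | rfl | rfl <;> rcases hb with rfl | rfl | rfl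
      all_goals first
        | exact SimpleGraph.Reachable.refl _
        | exact hP13
        | exact hP13.symm
        | exact hP23
        | exact hP23.symm
        | exact hP13.trans hP23.symm
        | exact hP23.trans hP13.symm
    · simp only [relOf, mem_cliq, Finset.mem_insert, Finset.mem_singleton] at h
      obtain ⟨hb, ha, _⟩ := h
      rcases ha with rfl | rfl | rfl <;> rcases hb with rfl | rfl | rfl
      all_goals first
        | exact SimpleGraph.Reachable.refl _
        | exact hP13
        | exact hP13.symm
        | exact hP23
        | exact hP23.symm
        | exact hP13.trans hP23.symm
        | exact hP23.trans hP13.symm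
  constructor
  · intro h
    rw [SimpleGraph.reachable_iff_reflTransGen] at h
    induction h with
    | refl => exact SimpleGraph.Reachable.refl _
    | tail _ hxy ih => exact ih.trans (hPT _ _ hxy)
  · intro h
    rw [SimpleGraph.reachable_iff_reflTransGen] at h
    induction h with
    | refl => exact SimpleGraph.Reachable.refl _
    | tail _ hxy ih => exact ih.trans (hTP _ _ hxy)

end Masks

end Mask

end TypedRed

end CovForm

end Summit.Ventures.PercRepro2
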